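import Summits.AtomisticToContinuum.HydrodynamicLimit.Theorems.BoxDissipativeWeakStrongFluxClosureOfParts
import HarnessLib

/-!
# Rung 0 of crux `FluxClosure` (route `BoxDissipativeWeakStrong`, item stmt-AtomisticToContinuum-9902):
integrability and measurability plumbing for the assembly of the homogeneous (global-equilibrium) case

Support lemmas of the lead prover (line `registered`, sub-goal E8 `fluxClosure_homogeneous`). The crux's
momentum-balance defect `D_N(z) = [∫⟪m̂, w⟫]_0^τ − ∫_{(0,τ]} ∫ (⟪m̂, ∂ₜw⟫ + Σᵢⱼ (m̂ᵢm̂ⱼ/ρ̂) ∂ⱼwᵢ + p_cut div w)`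
is assembled from its three interior pieces; to split the iterated Bochner integrals one needs, along the
orbit of a GOOD datum (speeds bounded by energy conservation), integrability in `t ∈ (0,τ]` of each frozen-time
space integral and integrability in `x` of each frozen-time integrand (`E8_orbit_integrable`, the piecewise twin
of `FluxClosureB4.integrableOn_boxFunctionals`), and a.e.-measurability in the datum of time–space integrals of
box functionals along the flow (`E8_aemeasurable_tsIntegral`, the generic form of
`FluxClosureB5.aemeasurable_fluxPairing`). No definitions, no limits; pure bookkeeping.
-/

noncomputable section

namespace Summit.AtomisticToContinuum.HydrodynamicLimit.Theorems
namespace FluxClosureEq.E8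

open scoped BigOperators Topology Classical MeasureTheory ProbabilityTheory InnerProductSpace ENNReal
open Filter Set Function MeasureTheory
open Literature.MathematicalPhysics.KineticTheory Literature.Analysis.FluidPDE Literature.Analysis.FunctionSpaces

variable {n : ℕ}

/-- Slices of a jointly measurable function on `ℝ × 𝕋³` bounded on `[0, τ] × 𝕋³` are integrable on `𝕋³` for
`t ∈ [0, τ]` (Haar probability measure; `Integrable.of_bound`). [folklore] -/
theorem E8_integrable_slice {G : ℝ × T3 → ℝ} (hG : Measurable G) {τ C : ℝ}
    (hC : ∀ p : ℝ × T3, p.1 ∈ Icc 0 τ → |G p| ≤ C) {t : ℝ} (ht : t ∈ Icc 0 τ) :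
    Integrable fun x => G (t, x) :=
  Integrable.of_bound (hG.comp (measurable_const.prodMk measurable_id)).aestronglyMeasurable C
    (Eventually.of_forall fun x => (Real.norm_eq_abs _).trans_le (hC (t, x) ht))

/-- **Piecewise integrability of the interior box functionals along an orbit** (the piece-by-piece twin of
`FluxClosureB4.integrableOn_boxFunctionals`). Along a measurable configuration path `γ` with speeds `≤ V`, for
a jointly measurable two-valued box kernel `0 ≤ k ≤ κ`, a test field `w` smooth on `[0,T) × 𝕋³` and
`τ ∈ [0, T)`: each of the three interior pieces of the crux's momentum-balance defect — the pairing `∫⟪m̂, ∂ₜw⟫`,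
the convective term `∫ Σᵢⱼ (m̂ᵢm̂ⱼ/ρ̂) ∂ⱼwᵢ` and the cut-pressure term `∫ ρ̂θ̂ Z(min(ρ̂σ³, η₁)) div w` — is
integrable in `t` on `(0, τ]`, and for every `t ∈ (0, τ]` its integrand is integrable on `𝕋³` (jointly
measurable in `(t, x)` through a measurable field of space–time derivatives of the lift,
`FluxClosureB4.exists_measurable_fderiv`, and bounded on `[0,τ] × 𝕋³`). [folklore] -/
theorem E8_orbit_integrable {γ : ℝ → Config n (Fin 3) T3} (hγ : Measurable γ) {Vb : ℝ}
    (hVb : 0 ≤ Vb) (hV : ∀ t i, ‖(γ t i).2‖ ≤ Vb) {k : T3 → T3 → ℝ}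
    (hk : Measurable fun p : T3 × T3 => k p.1 p.2) {kb : ℝ} (hk0 : ∀ x y, 0 ≤ k x y)
    (hkb : ∀ x y, k x y ≤ kb) (hkv : ∀ x y, k x y = 0 ∨ k x y = kb) {T τ : ℝ} (hτ : τ ∈ Ico 0 T)
    {w : ℝ → T3 → V3} (hw : Torus.IsSmoothSpaceTimeOn (Ico 0 T) w) (σ η₁ : ℝ) :
    IntegrableOn (fun t => ∫ x, inner ℝ (empiricalMomentumField (γ t) (k x)) (Torus.timeDerivWithin (Ico 0 T) w t x)) (Ioc 0 τ) ∧
    IntegrableOn (fun t => ∫ x, ∑ i, ∑ j, empiricalMomentumField (γ t) (k x) i * empiricalMomentumField (γ t) (k x) j / empiricalDensityField (γ t) (k x) * Torus.partialDeriv j (fun y => w t y i) x) (Ioc 0 τ) ∧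
    IntegrableOn (fun t => ∫ x, empiricalDensityField (γ t) (k x) * (2 / 3 * (empiricalEnergyField (γ t) (k x) / empiricalDensityField (γ t) (k x) - ‖empiricalMomentumField (γ t) (k x)‖ ^ 2 / (2 * empiricalDensityField (γ t) (k x) ^ 2))) * hsCompressibility (min (empiricalDensityField (γ t) (k x) * σ ^ 3) η₁) * Torus.divergence (w t) x) (Ioc 0 τ) ∧
    (∀ t ∈ Ioc 0 τ, Integrable fun x => inner ℝ (empiricalMomentumField (γ t) (k x)) (Torus.timeDerivWithin (Ico 0 T) w t x)) ∧
    (∀ t ∈ Ioc 0 τ, Integrable fun x => ∑ i, ∑ j, empiricalMomentumField (γ t) (k x) i * empiricalMomentumField (γ t) (k x) j / empiricalDensityField (γ t) (k x) * Torus.partialDeriv j (fun y => w t y i) x) ∧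
    (∀ t ∈ Ioc 0 τ, Integrable fun x => empiricalDensityField (γ t) (k x) * (2 / 3 * (empiricalEnergyField (γ t) (k x) / empiricalDensityField (γ t) (k x) - ‖empiricalMomentumField (γ t) (k x)‖ ^ 2 / (2 * empiricalDensityField (γ t) (k x) ^ 2))) * hsCompressibility (min (empiricalDensityField (γ t) (k x) * σ ^ 3) η₁) * Torus.divergence (w t) x) := by
  have hτT : τ < T := hτ.2
  obtain ⟨H, C, hHm, hHt, hHs, hHC⟩ := FluxClosureB4.exists_measurable_fderiv hτT hw
  -- scalar inequalities
  have abs_mul_le_mul : ∀ {a b A B : ℝ}, |a| ≤ A → |b| ≤ B → |a * b| ≤ A * B := fun ha hb => by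
    rw [abs_mul]; exact mul_le_mul ha hb (abs_nonneg _) ((abs_nonneg _).trans ha)
  have abs_sum_sum_le : ∀ {f : Fin 3 → Fin 3 → ℝ} {c : ℝ}, (∀ i j, |f i j| ≤ c) → |∑ i, ∑ j, f i j| ≤ 9 * c :=
    fun h => ((Finset.abs_sum_le_sum_abs _ _).trans (Finset.sum_le_sum fun i _ =>
      (Finset.abs_sum_le_sum_abs _ _).trans (Finset.sum_le_sum fun j _ => h i j))).trans (by simp; linarith)
  have abs_sum_le : ∀ {f : Fin 3 → ℝ} {c : ℝ}, (∀ i, |f i| ≤ c) → |∑ i, f i| ≤ 3 * c := fun h =>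
    ((Finset.abs_sum_le_sum_abs _ _).trans (Finset.sum_le_sum fun i _ => h i)).trans (by simp)
  -- the box fields along the orbit as jointly measurable functions of `(t, x)`
  obtain ⟨D, hD⟩ : ∃ D : ℝ × T3 → ℝ, D = fun p => empiricalDensityField (γ p.1) (k p.2) := ⟨_, rfl⟩
  obtain ⟨M, hM⟩ : ∃ M : ℝ × T3 → V3, M = fun p => empiricalMomentumField (γ p.1) (k p.2) := ⟨_, rfl⟩
  obtain ⟨E, hE⟩ : ∃ E : ℝ × T3 → ℝ, E = fun p => empiricalEnergyField (γ p.1) (k p.2) := ⟨_, rfl⟩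
  obtain ⟨Z, hZ⟩ : ∃ Z : ℝ × T3 → ℝ, Z = fun p => hsCompressibility (min (D p * σ ^ 3) η₁) := ⟨_, rfl⟩
  obtain ⟨A, hA⟩ : ∃ A : ℝ × T3 → V3, A = fun p => H p (1, 0) := ⟨_, rfl⟩
  obtain ⟨B, hB⟩ : ∃ B : Fin 3 → Fin 3 → ℝ × T3 → ℝ,
      B = fun a b p => H p (0, EuclideanSpace.single a 1) b := ⟨_, rfl⟩
  have hq : ∀ i, Measurable fun p : ℝ × T3 => k p.2 ((γ p.1) i).1 := fun i =>
    hk.comp (measurable_snd.prodMk ((measurable_pi_apply i).comp (hγ.comp measurable_fst)).fst)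
  have hv : ∀ i, Measurable fun p : ℝ × T3 => ((γ p.1) i).2 := fun i =>
    ((measurable_pi_apply i).comp (hγ.comp measurable_fst)).snd
  have mD : Measurable D := by
    rw [hD]; simp only [empiricalDensityField_eq_sum]
    exact measurable_const.mul (Finset.measurable_sum _ fun i _ => hq i)
  have mM : Measurable M := by
    rw [hM]; simp only [empiricalMomentumField_eq_sum]
    exact Measurable.const_smul (Finset.measurable_sum Finset.univ fun i _ => (hq i).smul (hv i)) ((n : ℝ)⁻¹)
  have mE : Measurable E := by
    rw [hE]; simp only [empiricalEnergyField_eq_sum]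
    exact measurable_const.mul (Finset.measurable_sum _ fun i _ => (hq i).mul (((hv i).norm.pow_const 2).div_const 2))
  have mhs : Measurable hsCompressibility := measurable_const.add (measurable_id.mul (measurable_deriv _))
  have mZ : Measurable Z := hZ ▸ mhs.comp ((mD.mul_const _).min measurable_const)
  have mA : Measurable A := hA ▸ hHm.apply_continuousLinearMap _
  have mB : ∀ a b, Measurable (B a b) := fun a b => by
    rw [hB]
    exact (show Measurable fun v : V3 => v b by fun_prop).comp (hHm.apply_continuousLinearMap _)
  have mMi : ∀ i, Measurable fun p => M p i := fun i =>
    (show Measurable fun v : V3 => v i by fun_prop).comp mM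
  have hkb0 : 0 ≤ kb := (hk0 0 0).trans (hkb 0 0)
  have bAt : ∀ p, (0 ≤ D p ∧ D p ≤ kb) ∧ ‖M p‖ ≤ Vb * D p ∧ (0 ≤ E p ∧ E p ≤ Vb ^ 2 * D p) := fun p => by
    rw [hD, hM, hE]; exact FluxClosureB4.boxAtoms_bounds (γ p.1) (hk0 p.2) (hkb p.2) (hV p.1)
  obtain ⟨Zb, bZ⟩ : ∃ Zb : ℝ, ∀ p, |Z p| ≤ Zb := by
    refine ⟨∑ m ∈ Finset.range (n + 1), |hsCompressibility (min ((n : ℝ)⁻¹ * (m * kb) * σ ^ 3) η₁)|,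
      fun p => ?_⟩
    rw [hZ, hD]
    exact FluxClosureB4.abs_apply_empiricalDensityField_le (fun r => hsCompressibility (min (r * σ ^ 3) η₁)) (γ p.1) (hkv p.2)
  have bA : ∀ p : ℝ × T3, p.1 ∈ Icc 0 τ → ‖A p‖ ≤ C := fun p hp => by
    have h := (H p).le_of_opNorm_le (hHC p.1 hp p.2) ((1 : ℝ), (0 : EuclideanSpace ℝ (Fin 3)))
    rw [show ‖((1 : ℝ), (0 : EuclideanSpace ℝ (Fin 3)))‖ = 1 by simp [Prod.norm_def], mul_one] at h
    rw [hA]; exact h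
  have bB : ∀ a b (p : ℝ × T3), p.1 ∈ Icc 0 τ → |B a b p| ≤ C := fun a b p hp => by
    have h := (H p).le_of_opNorm_le (hHC p.1 hp p.2) ((0 : ℝ), EuclideanSpace.single a (1 : ℝ))
    rw [show ‖((0 : ℝ), EuclideanSpace.single a (1 : ℝ))‖ = 1 by simp [Prod.norm_def], mul_one] at h
    rw [hB]; exact le_trans (by simpa using PiLp.norm_apply_le (H p (0, EuclideanSpace.single a 1)) b) h
  have bTh : ∀ p, |D p * (2 / 3 * (E p / D p - ‖M p‖ ^ 2 / (2 * D p ^ 2)))| ≤ kb * Vb ^ 2 := fun p =>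
    abs_mul_le_mul (by rw [abs_of_nonneg (bAt p).1.1]; exact (bAt p).1.2)
      (FluxClosureB4.abs_boxTemp_le (bAt p).1.1 (bAt p).2.1 (bAt p).2.2.1 (bAt p).2.2.2)
  have bQ : ∀ p i j, |M p i * M p j / D p| ≤ Vb ^ 2 * kb := fun p i j =>
    FluxClosureB4.abs_mul_div_le (bAt p).1.1 (bAt p).1.2 (bAt p).2.1 i j
  have eQ : ∀ t ∈ Ico 0 T, ∀ x, Torus.timeDerivWithin (Ico 0 T) w t x = A (t, x) := fun t ht x => by
    rw [hA, hHt t ht x]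
  have eB : ∀ t ∈ Ico 0 T, ∀ x (a b : Fin 3), Torus.partialDeriv a (fun y => w t y b) x = B a b (t, x) :=
    fun t ht x a b => by rw [hB, hHs t ht x a b]
  have eDiv : ∀ t ∈ Ico 0 T, ∀ x, Torus.divergence (w t) x = ∑ i, B i i (t, x) := fun t ht x => by
    simp only [Torus.divergence, eB t ht x]
  have hIoc : ∀ t ∈ Ioc 0 τ, t ∈ Ico 0 T ∧ t ∈ Icc 0 τ := fun t ht =>
    ⟨⟨ht.1.le, lt_of_le_of_lt ht.2 hτT⟩, ⟨ht.1.le, ht.2⟩⟩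
  -- the three jointly measurable integrands `G₁, G₂, G₃`, their slab identities and bounds
  have mG₁ : Measurable fun p : ℝ × T3 => ⟪M p, A p⟫_ℝ := mM.inner mA
  have eG₁ : ∀ t ∈ Ico 0 T, ∀ x, inner ℝ (empiricalMomentumField (γ t) (k x)) (Torus.timeDerivWithin (Ico 0 T) w t x) =
      (fun p : ℝ × T3 => ⟪M p, A p⟫_ℝ) (t, x) := fun t ht x => by
    simp only [eQ t ht x, hM]
  have bG₁ : ∀ p : ℝ × T3, p.1 ∈ Icc 0 τ → |(fun p : ℝ × T3 => ⟪M p, A p⟫_ℝ) p| ≤ Vb * kb * C := fun p hp =>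
    (abs_real_inner_le_norm _ _).trans (mul_le_mul (((bAt p).2.1).trans
      (mul_le_mul_of_nonneg_left (bAt p).1.2 hVb)) (bA p hp) (norm_nonneg _) (mul_nonneg hVb hkb0))
  have mG₂ : Measurable fun p : ℝ × T3 => ∑ i, ∑ j, M p i * M p j / D p * B j i p := by
    refine Finset.measurable_sum _ fun i _ => Finset.measurable_sum _ fun j _ => ?_
    exact (((mMi i).mul (mMi j)).div mD).mul (mB j i)
  have eG₂ : ∀ t ∈ Ico 0 T, ∀ x, (∑ i, ∑ j, empiricalMomentumField (γ t) (k x) i * empiricalMomentumField (γ t) (k x) j / empiricalDensityField (γ t) (k x) * Torus.partialDeriv j (fun y => w t y i) x) =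
      (fun p : ℝ × T3 => ∑ i, ∑ j, M p i * M p j / D p * B j i p) (t, x) := fun t ht x => by
    simp only [eB t ht x, hD, hM]
  have bG₂ : ∀ p : ℝ × T3, p.1 ∈ Icc 0 τ → |(fun p : ℝ × T3 => ∑ i, ∑ j, M p i * M p j / D p * B j i p) p| ≤
      9 * (Vb ^ 2 * kb * C) := fun p hp => abs_sum_sum_le fun i j => abs_mul_le_mul (bQ p i j) (bB j i p hp)
  have mG₃ : Measurable fun p : ℝ × T3 => D p * (2 / 3 * (E p / D p - ‖M p‖ ^ 2 / (2 * D p ^ 2))) * Z p * ∑ i, B i i p := by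
    have h1 : Measurable fun p : ℝ × T3 => D p * (2 / 3 * (E p / D p - ‖M p‖ ^ 2 / (2 * D p ^ 2))) :=
      mD.mul (((mE.div mD).sub ((mM.norm.pow_const 2).div ((mD.pow_const 2).const_mul 2))).const_mul _)
    exact (h1.mul mZ).mul (Finset.measurable_sum _ fun i _ => mB i i)
  have eG₃ : ∀ t ∈ Ico 0 T, ∀ x, empiricalDensityField (γ t) (k x) * (2 / 3 * (empiricalEnergyField (γ t) (k x) / empiricalDensityField (γ t) (k x) - ‖empiricalMomentumField (γ t) (k x)‖ ^ 2 / (2 * empiricalDensityField (γ t) (k x) ^ 2))) * hsCompressibility (min (empiricalDensityField (γ t) (k x) * σ ^ 3) η₁) * Torus.divergence (w t) x =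
      (fun p : ℝ × T3 => D p * (2 / 3 * (E p / D p - ‖M p‖ ^ 2 / (2 * D p ^ 2))) * Z p * ∑ i, B i i p) (t, x) := fun t ht x => by
    simp only [eDiv t ht x, hD, hM, hE, hZ]
  have bG₃ : ∀ p : ℝ × T3, p.1 ∈ Icc 0 τ → |(fun p : ℝ × T3 => D p * (2 / 3 * (E p / D p - ‖M p‖ ^ 2 / (2 * D p ^ 2))) * Z p * ∑ i, B i i p) p| ≤
      kb * Vb ^ 2 * Zb * (3 * C) := fun p hp =>
    abs_mul_le_mul (abs_mul_le_mul (bTh p) (bZ p)) (abs_sum_le fun i => bB i i p hp)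
  refine ⟨?_, ?_, ?_, ?_, ?_, ?_⟩
  · exact FluxClosureB4.integrableOn_Ioc_integral hτT mG₁ eG₁ bG₁
  · exact FluxClosureB4.integrableOn_Ioc_integral hτT mG₂ eG₂ bG₂
  · exact FluxClosureB4.integrableOn_Ioc_integral hτT mG₃ eG₃ bG₃
  · intro t ht
    have h := E8_integrable_slice mG₁ bG₁ (hIoc t ht).2
    exact h.congr (ae_of_all _ fun x => (eG₁ t (hIoc t ht).1 x).symm)
  · intro t ht
    have h := E8_integrable_slice mG₂ bG₂ (hIoc t ht).2
    exact h.congr (ae_of_all _ fun x => (eG₂ t (hIoc t ht).1 x).symm)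
  · intro t ht
    have h := E8_integrable_slice mG₃ bG₃ (hIoc t ht).2
    exact h.congr (ae_of_all _ fun x => (eG₃ t (hIoc t ht).1 x).symm)

/-- **A.e.-measurability of time–space integrals of box functionals along the flow** (generic form of
`FluxClosureB5.aemeasurable_fluxPairing`). For a hard-sphere flow `Ψ` on `𝕋³`, a law `μ` carried by its good set,
`τ`, and an integrand `f t c x` that agrees for `t ∈ (0, τ]` with a jointly measurable `F ((t, c), x)`:
`z ↦ ∫_{(0,τ]} ∫ f t (Ψ_t z) x dx dt` is `μ`-a.e. measurable (the flow is jointly measurable on `good × ℝ`,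
`HardSphereFlow.measurable_flow_prod_torus`). [folklore] -/
theorem E8_aemeasurable_tsIntegral {ε : ℝ} (Ψ : HardSphereFlow (Torus.geometry (Fin 3)) ε n)
    {f : ℝ → Config n (Fin 3) T3 → T3 → ℝ} {F : (ℝ × Config n (Fin 3) T3) × T3 → ℝ} (hF : Measurable F)
    {τ : ℝ} (hfF : ∀ t ∈ Ioc 0 τ, ∀ c x, f t c x = F ((t, c), x))
    {μ : Measure (Config n (Fin 3) T3)} (hμ : μ Ψ.goodᶜ = 0) :
    AEMeasurable (fun z : Config n (Fin 3) T3 => ∫ t in Ioc 0 τ, ∫ x, f t (Ψ.flow t z) x) μ := by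
  -- integrate out `x`
  have hH : StronglyMeasurable fun p : ℝ × Config n (Fin 3) T3 => ∫ x, F (p, x) :=
    hF.stronglyMeasurable.integral_prod_right'
  -- compose with the flow, jointly measurable on `good × ℝ`, and integrate out `t`
  have hG : StronglyMeasurable fun p : Ψ.good × ℝ => ∫ x, F ((p.2, Ψ.flow p.2 (p.1 : Config n (Fin 3) T3)), x) :=
    hH.comp_measurable (measurable_snd.prodMk Ψ.measurable_flow_prod_torus)
  have hI : StronglyMeasurable fun z : Ψ.good => ∫ t in Ioc 0 τ, ∫ x,
      F ((t, Ψ.flow t (z : Config n (Fin 3) T3)), x) :=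
    hG.integral_prod_right'
  refine Ψ.aemeasurable_of_measurable_comp_subtype ?_ hμ
  have heq : (fun z : Ψ.good => ∫ t in Ioc 0 τ, ∫ x, f t (Ψ.flow t (z : Config n (Fin 3) T3)) x) =
      fun z : Ψ.good => ∫ t in Ioc 0 τ, ∫ x, F ((t, Ψ.flow t (z : Config n (Fin 3) T3)), x) := by
    funext z
    refine setIntegral_congr_fun measurableSet_Ioc fun t ht => ?_
    simp only [hfF t ht]
  rw [heq]
  exact hI.measurable

/-- Explicit-binder restatement of `E8_aemeasurable_tsIntegral` (the registered helper signature of this support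
file): a.e.-measurability in the datum of time–space integrals of box functionals along a hard-sphere flow, for laws
carried by the good set. [folklore] -/
theorem E8_aemeasurable_tsIntegral_explicit : ∀ (n : ℕ) (ε : ℝ) (Ψ : HardSphereFlow (Torus.geometry (Fin 3)) ε n) (f : ℝ → Config n (Fin 3) T3 → T3 → ℝ) (F : (ℝ × Config n (Fin 3) T3) × T3 → ℝ), Measurable F → ∀ (τ : ℝ), (∀ t ∈ Ioc 0 τ, ∀ c x, f t c x = F ((t, c), x)) → ∀ (μ : Measure (Config n (Fin 3) T3)), μ Ψ.goodᶜ = 0 → AEMeasurable (fun z : Config n (Fin 3) T3 => ∫ t in Ioc 0 τ, ∫ x, f t (Ψ.flow t z) x) μ :=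
  fun _ _ Ψ _ _ hF _ hfF _ hμ => E8_aemeasurable_tsIntegral Ψ hF hfF hμ

end FluxClosureEq.E8
end Summit.AtomisticToContinuum.HydrodynamicLimit.Theorems

end
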